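import Summits.ValiantsHypothesis.ValiantsHypothesis.Theorems.SymPencilSingFiveLeafWcolNormal

/-!
# Route `SymPencil` — the V-side of the size-27 cell `(11, 5, 4)`, PORT of val-idea-18's cascade, leaf E (part 3: general position)
# (`--supports` stmt-ValiantsHypothesis-5674 `SdcSuperquadratic`; port of §2b of
# `Cruxes/SdcSuperquadratic/Lines/sing_five_classification.lean` rev 10 (val-idea-18 g5); PORT-PLAN-115.md; rung currency only)

`wcolFive`: leaf E in general position — the workfile's `stub_wcolFive` with `InWCol` / `PerPointFour` / `VTorusType` unfolded
(transport to `wcolFive01` by `prodCongr`).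

Honest framing: [folklore] a verbatim port (the elementary matrices `cellE p` spelled `Pi.single p 1`); `27 ≤ sdc(per₄) ≤ 29`
unchanged; the crux `SdcSuperquadratic` and `VP ≠ VNP` untouched; no summit statement is proved here.  No definitions, no named facts.
-/

noncomputable section

-- single-conjunct layout: Sub = Summit, duplicated namespace component intended
set_option linter.dupNamespace false

namespace Summit.ValiantsHypothesis.ValiantsHypothesis.Theorems.SymPencilSingFiveClassification

open MvPolynomial Module Matrix
open scoped Polynomial
open Literature.Computability.AlgebraicComplexity
open Summit.ValiantsHypothesis.ValiantsHypothesis.Theorems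
open Summit.ValiantsHypothesis.ValiantsHypothesis.Theorems.SymPencilSingSixClassification
open Summit.ValiantsHypothesis.ValiantsHypothesis.Theorems.SymPencilPerFourJointFamilyTransport

variable {K : Type*} [Field K]

/-- **Leaf E** (`stub_wcolFive` unfolded): transport to the normal position `p = σ 0, q = σ 1,
m = τ 3` by `funCongrLeft (prodCongr σ τ)` (per-preserving … (memo). [folklore] -/
theorem wcolFive [CharZero K] (W : Submodule K (Fin 4 × Fin 4 → K)) (h5 : finrank K W = 5)
    (p q m : Fin 4) (hpq : p ≠ q)
    (hcol : ∀ x ∈ W, (∀ i j : Fin 4, i ≠ p → i ≠ q → x (i, j) = 0) ∧ x (p, m) = 0 ∧ x (q, m) = 0)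
    (hP : ∀ u : Fin 4 × Fin 4 → K, ∃ (c : Fin 4 → K) (Λ : Fin 4 → ((Fin 4 × Fin 4 → K) →ₗ[K] K)),
      ∀ y ∈ W, ∃ e₀ e₁ : K, ∀ s : K,
        eval (u + s • y) (perPoly (Fin 4) K) = e₀ + s * e₁ + s ^ 2 * ∑ k, c k * (Λ k y) ^ 2) :
    ∃ (σ τ : Equiv.Perm (Fin 4)) (θ : Fin 4 → K), θ 3 = 0 ∧ θ ≠ 0 ∧
      ∀ x : Fin 4 × Fin 4 → K, x ∈ W ↔
        ((∀ j, x (σ 2, j) = 0) ∧ (∀ j, x (σ 3, j) = 0) ∧ x (σ 0, τ 3) = 0 ∧ x (σ 1, τ 3) = 0 ∧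
          ∑ j, θ j * x (σ 1, τ j) = 0) := by
  classical
  obtain ⟨σ, hσ0, hσ1⟩ := exists_perm_zero_one p q hpq
  set τ : Equiv.Perm (Fin 4) := Equiv.swap 3 m with hτ
  have hτ3 : τ 3 = m := by rw [hτ, Equiv.swap_apply_left]
  set Φ : (Fin 4 × Fin 4 → K) ≃ₗ[K] (Fin 4 × Fin 4 → K) :=
    LinearEquiv.funCongrLeft K K (Equiv.prodCongr σ τ) with hΦ
  have hΦa : ∀ (x : Fin 4 × Fin 4 → K) (i j : Fin 4), Φ x (i, j) = x (σ i, τ j) := fun x i j => rfl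
  set W' := W.map Φ.toLinearMap with hW'def
  have hfin : finrank K W' = 5 := by rw [hW'def, LinearEquiv.finrank_map_eq, h5]
  have h20 : (2 : Fin 4) ≠ 0 := by decide
  have h21 : (2 : Fin 4) ≠ 1 := by decide
  have h30 : (3 : Fin 4) ≠ 0 := by decide
  have h31 : (3 : Fin 4) ≠ 1 := by decide
  have hσ2p : σ 2 ≠ p := fun h => h20 (σ.injective (h.trans hσ0.symm))
  have hσ2q : σ 2 ≠ q := fun h => h21 (σ.injective (h.trans hσ1.symm))
  have hσ3p : σ 3 ≠ p := fun h => h30 (σ.injective (h.trans hσ0.symm))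
  have hσ3q : σ 3 ≠ q := fun h => h31 (σ.injective (h.trans hσ1.symm))
  have hWc' : ∀ x ∈ W', (∀ j, x (2, j) = 0) ∧ (∀ j, x (3, j) = 0) ∧ x (0, 3) = 0 ∧
      x (1, 3) = 0 := by
    rintro _ ⟨x, hx, rfl⟩
    obtain ⟨hoff, hpm, hqm⟩ := hcol x hx
    refine ⟨fun j => ?_, fun j => ?_, ?_, ?_⟩
    · show Φ x (2, j) = 0
      rw [hΦa]; exact hoff _ _ hσ2p hσ2q
    · show Φ x (3, j) = 0
      rw [hΦa]; exact hoff _ _ hσ3p hσ3q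
    · show Φ x (0, 3) = 0
      rw [hΦa, hσ0, hτ3]; exact hpm
    · show Φ x (1, 3) = 0
      rw [hΦa, hσ1, hτ3]; exact hqm
  have hP' := perPointFour_map' W Φ
    (fun z => SymPencilPerFourBlocks.eval_perPoly_comp_prodCongr σ τ z) hP
  obtain ⟨i, θ, hi, hθ3, hθne, hmem'⟩ := wcolFive01 W' hfin hWc' hP'
  have hmemW : ∀ x : Fin 4 × Fin 4 → K, x ∈ W ↔ Φ x ∈ W' := fun x => by
    rw [hW'def, Submodule.mem_map_equiv, LinearEquiv.symm_apply_apply]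
  have hrow : ∀ (x : Fin 4 × Fin 4 → K) (r : Fin 4),
      (∀ j, x (r, τ j) = 0) ↔ (∀ j, x (r, j) = 0) := by
    intro x r
    constructor
    · intro h j
      have h' := h (τ.symm j)
      rwa [Equiv.apply_symm_apply] at h'
    · intro h j
      exact h (τ j)
  rcases hi with rfl | rfl
  · -- the equation sits on row `σ 0`: relabel by `σ · (0 1)`
    refine ⟨σ * Equiv.swap 0 1, τ, θ, hθ3, hθne, fun x => ?_⟩
    have e0 : (σ * Equiv.swap (0 : Fin 4) 1) 0 = σ 1 := by
      rw [Equiv.Perm.mul_apply, Equiv.swap_apply_left]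
    have e1 : (σ * Equiv.swap (0 : Fin 4) 1) 1 = σ 0 := by
      rw [Equiv.Perm.mul_apply, Equiv.swap_apply_right]
    have e2 : (σ * Equiv.swap (0 : Fin 4) 1) 2 = σ 2 := by
      rw [Equiv.Perm.mul_apply, Equiv.swap_apply_of_ne_of_ne h20 h21]
    have e3 : (σ * Equiv.swap (0 : Fin 4) 1) 3 = σ 3 := by
      rw [Equiv.Perm.mul_apply, Equiv.swap_apply_of_ne_of_ne h30 h31]
    rw [e0, e1, e2, e3, hmemW x, hmem' (Φ x)]
    simp only [hΦa]
    rw [hrow x (σ 2), hrow x (σ 3)]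
    constructor
    · rintro ⟨a, b, c, d, e⟩
      exact ⟨a, b, d, c, e⟩
    · rintro ⟨a, b, c, d, e⟩
      exact ⟨a, b, d, c, e⟩
  · refine ⟨σ, τ, θ, hθ3, hθne, fun x => ?_⟩
    rw [hmemW x, hmem' (Φ x)]
    simp only [hΦa]
    rw [hrow x (σ 2), hrow x (σ 3)]

end Summit.ValiantsHypothesis.ValiantsHypothesis.Theorems.SymPencilSingFiveClassification
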